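import Summits.Ventures.DiscreteObjects.UnitDistance.PlaneSqrt335Rup2
import Summits.Ventures.DiscreteObjects.UnitDistance.QuadraticFieldsAtlas
import Summits.Ventures.DiscreteObjects.UnitDistance.PlaneSqrt11Four
import Summits.Ventures.DiscreteObjects.UnitDistance.KernelRupCnfValid
import HarnessLib

/-!
# `χ(ℚ(√335)²) ≥ 4`: the plane over `ℚ(√335)` is not 3-colourable (cell `pub-namedobj`, target (U), seat udg g15)

Framing (verbatim for the cell): lottery ticket; floor = certified bounds/negative ranges.

Before this file the tree had no row for `d = 335 = 5·67` (beyond the quadratic tables of `QuadraticPlanesFourD/E`); its criteria give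
`3 ≤ χ(ℚ(√335)²) ≤ 5`: the odd cycle of `OddCycles.lean` (`335 ≡ 3 (mod 4)`) and the `11`-adic criterion (`335 ≡ 4² (mod 11)`); no
4-colouring is known (`335 ≡ 7 (mod 8)`, `≡ 2 (mod 3)`, a non-residue mod `7` and mod `19`).  Here the lower bound is raised to `4` by a
480-vertex witness (seat udg g15), so `χ(ℚ(√335)²) ∈ {4, 5}` — the fourth such row after `d = 47, 143, 311`.  The abstract
graph `w335Graph` on `Fin 480` (adjacency = the exact integer unit test `unitStep335` on the coordinate table of
`PlaneSqrt335WitnessData.lean`) is not 3-colourable (kernel RUP certificate `w335rup1…`, soundness `KRup.checkAll_sound`); the map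
`v ↦ pt335 (w335c v)` is a graph homomorphism into the unit-distance graph of `ℚ(√335)²` (`w335Hom`); hence `4 ≤ χ(ℚ(√335)²) ≤ 5`
(`chromaticNumber_plane_sqrt335_bounds`) and `χ(K²) ≥ 4` for every field `K ∋ √335`.  The witness is triangle-free, as is every unit-distance
graph over `ℚ(√335)` (`TriangleFreeFieldPlanes.lean`); Madore (arXiv:1509.07023 §2): 'practically the only two useful graphs known
in this context are the triangle and Moser's spindle' — this one is neither.  Value and witness not found in print (PROVISIONAL).
-/

noncomputable section

namespace Summit.Ventures.DiscreteObjects.UnitDistance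

open SimpleGraph KRup IntermediateField
open scoped IntermediateField

/- Meta-level `whnf` must never evaluate the clause store (linters and the elaborator `whnf` types of the shape
   `Store.All _ (Store.ofList …)`); the kernel facts are untouched by this local attribute. -/
attribute [local irreducible] Store.ofList

/-! ## The abstract witness graph -/

/-- The integer unit test never holds between a point and itself (`0 ≠ 32400`). -/
theorem unitStep335_self (p : ℤ × ℤ × ℤ × ℤ) : unitStep335 p p = false := by
  simp [unitStep335]

/-- The integer unit test is symmetric. -/
theorem unitStep335_comm (p q : ℤ × ℤ × ℤ × ℤ) : unitStep335 p q = unitStep335 q p := by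
  have h1 : (p.1 - q.1) ^ 2 + 335 * (p.2.1 - q.2.1) ^ 2 + (p.2.2.1 - q.2.2.1) ^ 2 + 335 * (p.2.2.2 - q.2.2.2) ^ 2 =
      (q.1 - p.1) ^ 2 + 335 * (q.2.1 - p.2.1) ^ 2 + (q.2.2.1 - p.2.2.1) ^ 2 + 335 * (q.2.2.2 - p.2.2.2) ^ 2 := by ring
  have h2 : (p.1 - q.1) * (p.2.1 - q.2.1) + (p.2.2.1 - q.2.2.1) * (p.2.2.2 - q.2.2.2) =
      (q.1 - p.1) * (q.2.1 - p.2.1) + (q.2.2.1 - p.2.2.1) * (q.2.2.2 - p.2.2.2) := by ring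
  simp only [unitStep335, h1, h2]

/-- THE WITNESS GRAPH `W_335` on `Fin 480`: `v ~ w` iff the exact unit test holds on the coordinate table. -/
def w335Graph : SimpleGraph (Fin 480) where
  Adj v w := unitStep335 (w335c v) (w335c w) = true
  symm := ⟨fun v w h => by rw [unitStep335_comm]; exact h⟩
  loopless := ⟨fun v h => by rw [unitStep335_self] at h; exact Bool.false_ne_true h⟩

/-- Adjacency of the witness graph is decidable (it is a Boolean test). -/
instance : DecidableRel w335Graph.Adj := fun v w => inferInstanceAs (Decidable (unitStep335 (w335c v) (w335c w) = true))

/-- Every clause of the 3-colouring CNF has an admissible shape (vertex / edge-of-the-graph / unit) — an instance of the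
general `KRup.cnfOf_all_valid` (udg g14; no per-instance kernel evaluation). -/
theorem w335cnf_valid : (cnfOf w335nb 480 0 1).all (validClause w335nb 480 0 1) = true :=
  cnfOf_all_valid _ _ _ _

/-- KERNEL FACT: the last piece of the certificate derives the empty clause. -/
theorem w335nil : ([] : List ℕ) ∈ w335steps2.map Prod.fst := by
  decide +kernel

set_option maxRecDepth 2000000 in
/-- `W_335` IS NOT 3-COLOURABLE (kernel RUP certificate + `KRup.checkAll_sound`; WLOG `0 ↦ 0`, `1 ↦ 1`). -/
theorem not_colorable_three_w335Graph : ¬ w335Graph.Colorable 3 := by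
  rintro ⟨C⟩
  have h01 : C ⟨0, by norm_num⟩ ≠ C ⟨1, by norm_num⟩ := C.valid w335_edge01
  obtain ⟨σ, hσ0, hσ1⟩ := exists_perm_fin3 _ _ h01
  let col : ℕ → ℕ := fun v => if h : v < 480 then (σ (C ⟨v, h⟩)).val else 0
  have hcol : ∀ v (h : v < 480), col v = (σ (C ⟨v, h⟩)).val := fun v h => dif_pos h
  have hP : Proper3 w335nb 480 col := by
    intro v hv
    refine ⟨by rw [hcol v hv]; exact (σ (C ⟨v, hv⟩)).isLt, ?_⟩
    intro w hw hbit heq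
    have hu := (w335_unit_of_testBit v w hv hbit).2
    have hvalid : C ⟨v, hv⟩ ≠ C ⟨w, hw⟩ := C.valid hu
    rw [hcol v hv, hcol w hw] at heq
    exact hvalid (σ.injective (Fin.ext heq)).symm
  have h0 : col 0 = 0 := by rw [hcol 0 (by norm_num), hσ0]; rfl
  have h1 : col 1 = 1 := by rw [hcol 1 (by norm_num), hσ1]; rfl
  have H0 := all_true_of_valid hP h0 h1 w335cnf_valid
  have A1 : ∀ C ∈ cnfOf w335nb 480 0 1 ++ w335pre1, clauseTrue (assignOf col) C = true := by
    intro C hC; rw [List.mem_append] at hC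
    rcases hC with h | h
    · exact H0 C h
    · simp [w335pre1] at h
  have S1 : ∀ C ∈ w335steps1.map Prod.fst, clauseTrue (assignOf col) C = true :=
    checkAll_sound (σ := assignOf col) 496 14 (S := Store.ofList 14 (cnfOf w335nb 480 0 1 ++ w335pre1))
      _ w335steps1 (Store.All.ofList 14 A1) w335rup1
  have A2 : ∀ C ∈ cnfOf w335nb 480 0 1 ++ w335pre2, clauseTrue (assignOf col) C = true := by
    intro C hC
    simp only [w335pre2, List.mem_append] at hC
    rcases hC with h | h | h
    · exact A1 C (List.mem_append.2 (Or.inl h))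
    · exact A1 C (List.mem_append.2 (Or.inr h))
    · exact S1 C h
  have S2 : ∀ C ∈ w335steps2.map Prod.fst, clauseTrue (assignOf col) C = true :=
    checkAll_sound (σ := assignOf col) 496 14 (S := Store.ofList 14 (cnfOf w335nb 480 0 1 ++ w335pre2))
      _ w335steps2 (Store.All.ofList 14 A2) w335rup2
  have hnil := S2 [] w335nil
  simp [clauseTrue] at hnil

/- (An explicit 4-colouring of `W_335` is not kernel-checked over `480²` pairs, and `χ(W_335)` is NOT determined in this file: the tree
   has no 4-colouring of `ℚ(√335)²`, only the 11-adic 5-colouring, so the realisation below gives `4 ≤ χ(W_335) ≤ 5` at best — nothing about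
   `χ(W_335)` is asserted.  Wording fixed after verify-ref g132's reading; udg g15.) -/

/-! ## Realisation in `ℚ(√335)²` -/

/-- The plane point with integer data `(A, B, C, E)`: `((A + B√335)/180, (C + E√335)/180)`. -/
def pt335 (p : ℤ × ℤ × ℤ × ℤ) : EuclideanSpace ℝ (Fin 2) :=
  !₂[((p.1 : ℝ) + (p.2.1 : ℝ) * Real.sqrt 335) / 180, ((p.2.2.1 : ℝ) + (p.2.2.2 : ℝ) * Real.sqrt 335) / 180]

/-- The integer unit test implies unit distance. -/
theorem dist_pt335_eq_one {p q : ℤ × ℤ × ℤ × ℤ} (h : unitStep335 p q = true) : dist (pt335 p) (pt335 q) = 1 := by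
  obtain ⟨a, b, c, e⟩ := p
  obtain ⟨a', b', c', e'⟩ := q
  simp only [unitStep335, Bool.and_eq_true, beq_iff_eq] at h
  obtain ⟨h1, h2⟩ := h
  have s : Real.sqrt 335 ^ 2 = 335 := Real.sq_sqrt (by norm_num)
  have h1' : ((a' : ℝ) - a) ^ 2 + 335 * ((b' : ℝ) - b) ^ 2 + ((c' : ℝ) - c) ^ 2 + 335 * ((e' : ℝ) - e) ^ 2 = 32400 := by
    exact_mod_cast h1
  have h2' : ((a' : ℝ) - a) * ((b' : ℝ) - b) + ((c' : ℝ) - c) * ((e' : ℝ) - e) = 0 := by exact_mod_cast h2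
  have hd : dist (pt335 (a, b, c, e)) (pt335 (a', b', c', e')) ^ 2 = 1 := by
    rw [EuclideanSpace.dist_sq_eq, Fin.sum_univ_two, Real.dist_eq, Real.dist_eq, sq_abs, sq_abs]
    simp [pt335]
    linear_combination (1 / 32400 : ℝ) * h1' + (((b : ℝ) - b') ^ 2 + ((e : ℝ) - e') ^ 2) / 32400 * s +
      (2 * Real.sqrt 335 / 32400) * h2'
  exact (pow_eq_one_iff_of_nonneg dist_nonneg two_ne_zero).1 hd

/-- Every point `pt335 p` lies in `ℚ(√335)²`. -/
theorem pt335_mem (p : ℤ × ℤ × ℤ × ℤ) : pt335 p ∈ fieldPoints ℚ⟮Real.sqrt 335⟯ := by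
  have hs : Real.sqrt 335 ∈ ℚ⟮Real.sqrt 335⟯ := mem_adjoin_simple_self ℚ _
  intro i
  fin_cases i
  · change ((p.1 : ℝ) + (p.2.1 : ℝ) * Real.sqrt 335) / 180 ∈ ℚ⟮Real.sqrt 335⟯
    exact div_mem (add_mem (intCast_mem _ _) (mul_mem (intCast_mem _ _) hs)) (ofNat_mem _ 180)
  · change ((p.2.2.1 : ℝ) + (p.2.2.2 : ℝ) * Real.sqrt 335) / 180 ∈ ℚ⟮Real.sqrt 335⟯
    exact div_mem (add_mem (intCast_mem _ _) (mul_mem (intCast_mem _ _) hs)) (ofNat_mem _ 180)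

/-- The realisation homomorphism `W_335 →g Γ(ℚ(√335)²)`, `v ↦ pt335 (w335c v)`. -/
def w335Hom : w335Graph →g planeUnitDistanceGraph.induce (fieldPoints ℚ⟮Real.sqrt 335⟯) where
  toFun v := ⟨pt335 (w335c v), pt335_mem _⟩
  map_rel' h := dist_pt335_eq_one h

/-- THE PLANE OVER `ℚ(√335)` IS NOT 3-COLOURABLE. -/
theorem not_colorable_three_plane_sqrt335 :
    ¬ (planeUnitDistanceGraph.induce (fieldPoints ℚ⟮Real.sqrt 335⟯)).Colorable 3 :=
  fun h => not_colorable_three_w335Graph (h.of_hom w335Hom)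

/-- `4 ≤ χ(ℚ(√335)²) ≤ 5` (lower bound: the witness; upper bound: the 11-adic criterion `colorable_five_plane_of_elevenAdic` (`PadicPattern 11 {335}`)). -/
theorem chromaticNumber_plane_sqrt335_bounds :
    4 ≤ (planeUnitDistanceGraph.induce (fieldPoints ℚ⟮Real.sqrt 335⟯)).chromaticNumber ∧
      (planeUnitDistanceGraph.induce (fieldPoints ℚ⟮Real.sqrt 335⟯)).chromaticNumber ≤ 5 := by
  have h5 : (planeUnitDistanceGraph.induce (fieldPoints ℚ⟮Real.sqrt 335⟯)).Colorable 5 := by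
    have h := colorable_five_plane_of_elevenAdic {335} (by decide)
    rw [multiSqrtField_singleton, Nat.cast_ofNat] at h
    exact h
  refine ⟨?_, h5.chromaticNumber_le⟩
  by_contra hlt
  have hlt' : (planeUnitDistanceGraph.induce (fieldPoints ℚ⟮Real.sqrt 335⟯)).chromaticNumber < (3 : ℕ∞) + 1 :=
    lt_of_not_ge hlt
  have hle : (planeUnitDistanceGraph.induce (fieldPoints ℚ⟮Real.sqrt 335⟯)).chromaticNumber ≤ (3 : ℕ) :=
    Order.le_of_lt_add_one hlt'
  exact not_colorable_three_plane_sqrt335 (chromaticNumber_le_iff_colorable.mp hle)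

/-- Atlas form: `4 ≤ χ(ℚ(√d : d ∈ {335})²) ≤ 5`. -/
theorem chromaticNumber_plane_multiSqrtField_335_bounds :
    4 ≤ (planeUnitDistanceGraph.induce (fieldPoints (multiSqrtField {335}))).chromaticNumber ∧
      (planeUnitDistanceGraph.induce (fieldPoints (multiSqrtField {335}))).chromaticNumber ≤ 5 := by
  rw [multiSqrtField_singleton, Nat.cast_ofNat]
  exact chromaticNumber_plane_sqrt335_bounds

/-- Every field `K ⊇ ℚ(√335)` has `χ(K²) ≥ 4`. -/
theorem not_colorable_three_plane_of_sqrt335_mem (K : IntermediateField ℚ ℝ) (h : Real.sqrt 335 ∈ K) :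
    ¬ (planeUnitDistanceGraph.induce (fieldPoints K)).Colorable 3 := by
  have hle : ℚ⟮Real.sqrt 335⟯ ≤ K := adjoin_simple_le_iff.2 h
  exact fun hK => not_colorable_three_plane_sqrt335 (colorable_plane_of_le hle hK)

end Summit.Ventures.DiscreteObjects.UnitDistance
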